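import Literature.Geometry.Riemannian.MetricFlowSliceUnionBounds
import HarnessLib

/-!
# The average distance is almost continuous along a conjugate heat flow: the upper bound in
# (4.4) (Bamler 2023, §4.2, Lemma)

R. Bamler, *Compactness theory of the space of super Ricci flows*, Invent. Math. 233 (2023), §4.2,
Lemma (almost monotonicity of the average distance), the upper bound in (4.4): for an
`H`-concentrated metric flow, a conjugate heat flow `(μ_t)_{t ∈ I'}` and `s ≤ t` in `I'`,
`∫∫ d_t dμ_t dμ_t − ∫∫ d_s dμ_s dμ_s ≤ √(Var(μ_t) − Var(μ_s) + H(t − s)) + 2√(H(t − s))`.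
Printed proof: pointwise `|d_s(x₁, x₂) − √Var(ν_{y₁;s}, ν_{y₂;s})| ≤ √Var(δ_{x₁}, ν_{y₁;s}) +
√Var(δ_{x₂}, ν_{y₂;s})`, integrated against `ν_{y₁;s} ⊗ ν_{y₂;s}` (Jensen, `Var(ν_{y;s}) ≤ H(t − s)`):
`|∫∫ d_s dν_{y₁;s} dν_{y₂;s} − √Var(ν_{y₁;s}, ν_{y₂;s})| ≤ 2√(H(t − s))`; the algebra
`d_t − √Var ≤ √(d_t² − Var + H(t − s))` (using `H`-concentration `Var ≤ d_t² + H(t − s)`); and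
integration over `μ_t ⊗ μ_t` with Cauchy–Schwarz and
`∫∫ (d_t² − Var(ν_{y₁;s}, ν_{y₂;s}) + H(t − s)) dμ_t dμ_t = Var(μ_t) − Var(μ_s) + H(t − s)`.

* `rpow_half_variance_le_edist_add` — `√Var(ν₁, ν₂) ≤ d(x₁, x₂) + √Var(δ_{x₁}, ν₁) + √Var(δ_{x₂}, ν₂)`
  (Minkowski in `L²(ν₁ ⊗ ν₂)`);
* `MetricFlow.IsHConcentrated.rpow_half_variance_condKernel_le` —
  `√Var(ν_{y₁;s}, ν_{y₂;s}) ≤ ∫∫ d_s dν_{y₁;s} dν_{y₂;s} + 2√(H(t − s))`;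
* `MetricFlow.IsHConcentrated.edist_le_lintegral_lintegral_add` — the pointwise bound
  `d_t(y₁, y₂) ≤ ∫∫ d_s dν_{y₁;s} dν_{y₂;s} + √(d_t² + H(t − s) − Var) + 2√(H(t − s))`;
* `MetricFlow.IsHConcentrated.lintegral_lintegral_edist_le_add_sqrt` — **the upper bound in
  (4.4)** (additive `[0, ∞]` form, finite variances).

Everything is proved; no definitions, no named facts.

## References

* R. H. Bamler, *Compactness theory of the space of super Ricci flows*, Invent. Math. 233 (2023),
  §4.2, Lemma (almost monotonicity of the average distance), (4.4), upper bound. [Bamler2023]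
-/

noncomputable section

open Set MeasureTheory ProbabilityTheory Filter Topology
open scoped ENNReal NNReal

namespace Literature.Geometry.Riemannian

universe u

/-! ### Minkowski: `√Var(ν₁, ν₂) ≤ d(x₁, x₂) + √Var(δ_{x₁}, ν₁) + √Var(δ_{x₂}, ν₂)` -/

section Minkowski

variable {X : Type*} [MetricSpace X] [MeasurableSpace X] [BorelSpace X] [SecondCountableTopology X]

/-- **`√Var(ν₁, ν₂) ≤ d(x₁, x₂) + √Var(δ_{x₁}, ν₁) + √Var(δ_{x₂}, ν₂)`** (Bamler 2023, §4.2, proof of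
the Lemma: *"`|d_s(x₁, x₂) − √Var(ν_{y₁;s}, ν_{y₂;s})| = |√Var(δ_{x₁}, δ_{x₂}) − √Var(ν_{y₁;s}, ν_{y₂;s})|
≤ √Var(δ_{x₁}, ν_{y₁;s}) + √Var(δ_{x₂}, ν_{y₂;s})`"*, the direction used): Minkowski in
`L²(ν₁ ⊗ ν₂)` for `d(z₁, z₂) ≤ d(z₁, x₁) + d(x₁, x₂) + d(x₂, z₂)`.
[cite: Bamler2023, §4.2, proof of the Lemma (almost monotonicity), second display] -/
theorem rpow_half_variance_le_edist_add (ν₁ ν₂ : Measure X) [IsProbabilityMeasure ν₁]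
    [IsProbabilityMeasure ν₂] (x₁ x₂ : X) :
    (variance ν₁ ν₂) ^ (1 / 2 : ℝ) ≤ edist x₁ x₂ + (variance (Measure.dirac x₁) ν₁) ^ (1 / 2 : ℝ) +
      (variance (Measure.dirac x₂) ν₂) ^ (1 / 2 : ℝ) := by
  set π : Measure (X × X) := ν₁.prod ν₂ with hπ
  haveI : IsProbabilityMeasure π := by rw [hπ]; infer_instance
  -- the three functions
  set f : X × X → ℝ≥0∞ := fun z ↦ edist z.1 z.2 with hf
  set g₁ : X × X → ℝ≥0∞ := fun z ↦ edist x₁ z.1 with hg₁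
  set g₂ : X × X → ℝ≥0∞ := fun z ↦ edist x₂ z.2 with hg₂
  set c : X × X → ℝ≥0∞ := fun _ ↦ edist x₁ x₂ with hc
  have hfm : Measurable f := measurable_edist
  have hg₁m : Measurable g₁ := measurable_const.edist measurable_fst
  have hg₂m : Measurable g₂ := measurable_const.edist measurable_snd
  have hcm : Measurable c := measurable_const
  -- `‖·‖₂` of each
  have hnorm : ∀ {φ : X × X → ℝ≥0∞}, (∫⁻ z, φ z ^ (2 : ℝ) ∂π) ^ (1 / (2 : ℝ)) =
      (∫⁻ z, φ z ^ 2 ∂π) ^ (1 / 2 : ℝ) := fun {φ} ↦ by simp_rw [ENNReal.rpow_two]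
  have hVf : (∫⁻ z, f z ^ 2 ∂π) = variance ν₁ ν₂ := by
    rw [variance_def, hπ, lintegral_prod _ measurable_edist_sq.aemeasurable]
  have hVg₁ : (∫⁻ z, g₁ z ^ 2 ∂π) = variance (Measure.dirac x₁) ν₁ := by
    rw [variance_dirac_left, hπ, lintegral_prod _ ((hg₁m.pow_const 2).aemeasurable)]
    simp only [hg₁, lintegral_const, measure_univ, mul_one]
  have hVg₂ : (∫⁻ z, g₂ z ^ 2 ∂π) = variance (Measure.dirac x₂) ν₂ := by
    rw [variance_dirac_left, hπ, lintegral_prod _ ((hg₂m.pow_const 2).aemeasurable)]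
    simp only [hg₂, lintegral_const, measure_univ, mul_one]
  have hVc : (∫⁻ z, c z ^ 2 ∂π) ^ (1 / 2 : ℝ) = edist x₁ x₂ := by
    simp only [hc, lintegral_const, measure_univ, mul_one]
    rw [← ENNReal.rpow_natCast, ← ENNReal.rpow_mul]
    norm_num
  -- pointwise triangle inequality and monotonicity of `‖·‖₂`
  have hpt : ∀ z, f z ≤ (g₁ + c + g₂) z := fun z ↦ by
    simp only [hf, hg₁, hg₂, hc, Pi.add_apply]
    calc edist z.1 z.2 ≤ edist z.1 x₁ + edist x₁ x₂ + edist x₂ z.2 := edist_triangle4 _ _ _ _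
      _ = _ := by rw [edist_comm z.1 x₁]
  have hmono : (∫⁻ z, f z ^ (2 : ℝ) ∂π) ^ (1 / (2 : ℝ)) ≤
      (∫⁻ z, (g₁ + c + g₂) z ^ (2 : ℝ) ∂π) ^ (1 / (2 : ℝ)) :=
    ENNReal.rpow_le_rpow (lintegral_mono fun z ↦ ENNReal.rpow_le_rpow (hpt z) (by norm_num))
      (by norm_num)
  -- Minkowski twice
  have hM₁ := ENNReal.lintegral_Lp_add_le (μ := π) (hg₁m.add hcm).aemeasurable hg₂m.aemeasurable
    (p := 2) (by norm_num)
  have hM₂ := ENNReal.lintegral_Lp_add_le (μ := π) hg₁m.aemeasurable hcm.aemeasurable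
    (p := 2) (by norm_num)
  calc (variance ν₁ ν₂) ^ (1 / 2 : ℝ) = (∫⁻ z, f z ^ (2 : ℝ) ∂π) ^ (1 / (2 : ℝ)) := by
        rw [hnorm, hVf]
    _ ≤ (∫⁻ z, (g₁ + c + g₂) z ^ (2 : ℝ) ∂π) ^ (1 / (2 : ℝ)) := hmono
    _ ≤ (∫⁻ z, (g₁ + c) z ^ (2 : ℝ) ∂π) ^ (1 / (2 : ℝ)) + (∫⁻ z, g₂ z ^ (2 : ℝ) ∂π) ^ (1 / (2 : ℝ)) := hM₁
    _ ≤ ((∫⁻ z, g₁ z ^ (2 : ℝ) ∂π) ^ (1 / (2 : ℝ)) + (∫⁻ z, c z ^ (2 : ℝ) ∂π) ^ (1 / (2 : ℝ))) +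
          (∫⁻ z, g₂ z ^ (2 : ℝ) ∂π) ^ (1 / (2 : ℝ)) := add_le_add hM₂ le_rfl
    _ = (variance (Measure.dirac x₁) ν₁) ^ (1 / 2 : ℝ) + edist x₁ x₂ +
          (variance (Measure.dirac x₂) ν₂) ^ (1 / 2 : ℝ) := by
        rw [hnorm, hnorm, hnorm, hVg₁, hVg₂, hVc]
    _ = _ := by ring

end Minkowski

/-! ### An elementary inequality -/

/-- For reals `e, v, h ≥ 0` with `v ≤ e² + h`: `e ≤ √v + √(e² + h − v)` (if `e > √v`,
`(e − √v)² = e² − 2e√v + v ≤ e² + h − v` as `2√v(√v − e) ≤ 0 ≤ h`). [folklore] -/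
theorem le_sqrt_add_sqrt_sq_add_sub {e v h : ℝ} (hv : 0 ≤ v) (hh : 0 ≤ h)
    (hle : v ≤ e ^ 2 + h) : e ≤ Real.sqrt v + Real.sqrt (e ^ 2 + h - v) := by
  have hp : Real.sqrt v ^ 2 = v := Real.sq_sqrt hv
  have hq : Real.sqrt (e ^ 2 + h - v) ^ 2 = e ^ 2 + h - v := Real.sq_sqrt (by linarith)
  have hp0 : 0 ≤ Real.sqrt v := Real.sqrt_nonneg _
  have hq0 : 0 ≤ Real.sqrt (e ^ 2 + h - v) := Real.sqrt_nonneg _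
  by_cases hcase : e ≤ Real.sqrt v
  · linarith
  · rw [not_le] at hcase
    -- `e - √v ≤ √(e² + h − v)` by comparing squares
    have h1 : (e - Real.sqrt v) ^ 2 ≤ Real.sqrt (e ^ 2 + h - v) ^ 2 := by
      rw [hq]
      nlinarith
    have h2 : e - Real.sqrt v ≤ Real.sqrt (e ^ 2 + h - v) := by
      have h3 := Real.sqrt_le_sqrt h1
      rwa [Real.sqrt_sq (by linarith), Real.sqrt_sq hq0] at h3
    linarith

/-- The `[0, ∞]` form of `le_sqrt_add_sqrt_sq_add_sub`: for `a = edist y₁ y₂`, finite `V ≤ a² + ofReal h`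
(`h ≥ 0`), `a ≤ V^{1/2} + ((a² + ofReal h) − V)^{1/2}`. [folklore] -/
theorem edist_le_rpow_half_add_rpow_half {Y : Type*} [MetricSpace Y] (y₁ y₂ : Y) {V : ℝ≥0∞} {h : ℝ}
    (hh : 0 ≤ h) (hle : V ≤ edist y₁ y₂ ^ 2 + ENNReal.ofReal h) :
    edist y₁ y₂ ≤ V ^ (1 / 2 : ℝ) + ((edist y₁ y₂ ^ 2 + ENNReal.ofReal h) - V) ^ (1 / 2 : ℝ) := by
  set e : ℝ := dist y₁ y₂ with he
  have he0 : 0 ≤ e := dist_nonneg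
  have hsum : edist y₁ y₂ ^ 2 + ENNReal.ofReal h = ENNReal.ofReal (e ^ 2 + h) := by
    rw [edist_dist, ← ENNReal.ofReal_pow he0, ← ENNReal.ofReal_add (by positivity) hh]
  have hVtop : V ≠ ∞ := ne_top_of_le_ne_top (by rw [hsum]; exact ENNReal.ofReal_ne_top) hle
  set v : ℝ := V.toReal with hv
  have hv0 : 0 ≤ v := ENNReal.toReal_nonneg
  have hVv : V = ENNReal.ofReal v := (ENNReal.ofReal_toReal hVtop).symm
  have hvle : v ≤ e ^ 2 + h := by
    rw [hVv, hsum] at hle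
    exact (ENNReal.ofReal_le_ofReal_iff (by positivity)).1 hle
  have hreal := le_sqrt_add_sqrt_sq_add_sub hv0 hh hvle
  have h1 : V ^ (1 / 2 : ℝ) = ENNReal.ofReal (Real.sqrt v) := by
    rw [hVv, ENNReal.ofReal_rpow_of_nonneg hv0 (by norm_num), Real.sqrt_eq_rpow]
  have h2 : ((edist y₁ y₂ ^ 2 + ENNReal.ofReal h) - V) ^ (1 / 2 : ℝ) =
      ENNReal.ofReal (Real.sqrt (e ^ 2 + h - v)) := by
    rw [hsum, hVv, ← ENNReal.ofReal_sub _ hv0, ENNReal.ofReal_rpow_of_nonneg (by linarith) (by norm_num),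
      Real.sqrt_eq_rpow]
  rw [h1, h2, ← ENNReal.ofReal_add (Real.sqrt_nonneg _) (Real.sqrt_nonneg _), edist_dist]
  exact ENNReal.ofReal_le_ofReal hreal

/-! ### The metric flow estimates -/

namespace MetricFlow

variable {I : Set ℝ} {𝒳 : MetricFlow.{u} I}

/-- **`√Var(ν_{y₁;s}, ν_{y₂;s}) ≤ ∫∫ d_s dν_{y₁;s} dν_{y₂;s} + 2√(H(t − s))`** (Bamler 2023, §4.2,
proof of the Lemma, the integrated form of the second display:
`|∫∫ d_s dν_{y₁;s} dν_{y₂;s} − √Var(ν_{y₁;s}, ν_{y₂;s})| ≤ √Var(ν_{y₁;s}) + √Var(ν_{y₂;s}) ≤ 2√(H(t − s))`,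
the direction used), via `rpow_half_variance_le_edist_add`, Jensen and `Var(ν_{y;s}) ≤ H(t − s)`.
[cite: Bamler2023, §4.2, proof of the Lemma (almost monotonicity), third display] -/
theorem IsHConcentrated.rpow_half_variance_condKernel_le {H : ℝ} (hH : 𝒳.IsHConcentrated H)
    {s t : I} (hst : (s : ℝ) ≤ t) (y₁ y₂ : 𝒳.Slice t) :
    (variance (𝒳.condKernel y₁ s) (𝒳.condKernel y₂ s)) ^ (1 / 2 : ℝ) ≤
      ∫⁻ x₁, ∫⁻ x₂, edist x₁ x₂ ∂(𝒳.condKernel y₂ s) ∂(𝒳.condKernel y₁ s) +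
        2 * (ENNReal.ofReal (H * ((t : ℝ) - s))) ^ (1 / 2 : ℝ) := by
  haveI := 𝒳.isProbabilityMeasure_condKernel y₁ hst
  haveI := 𝒳.isProbabilityMeasure_condKernel y₂ hst
  haveI : SecondCountableTopology (𝒳.Slice s) := UniformSpace.secondCountable_of_separable _
  set ν₁ := 𝒳.condKernel y₁ s with hν₁
  set ν₂ := 𝒳.condKernel y₂ s with hν₂
  set c : ℝ≥0∞ := (ENNReal.ofReal (H * ((t : ℝ) - s))) ^ (1 / 2 : ℝ) with hc
  have hm₁ : Measurable fun x : 𝒳.Slice s ↦ (variance (Measure.dirac x) ν₁) ^ (1 / 2 : ℝ) :=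
    (measurable_variance_dirac _).pow_const _
  have hm₂ : Measurable fun x : 𝒳.Slice s ↦ (variance (Measure.dirac x) ν₂) ^ (1 / 2 : ℝ) :=
    (measurable_variance_dirac _).pow_const _
  -- Jensen + `Var(ν_{y;s}) ≤ H(t − s)`
  have hJ : ∀ {y : 𝒳.Slice t} (ν : Measure (𝒳.Slice s)), ν = 𝒳.condKernel y s →
      ∫⁻ x, (variance (Measure.dirac x) ν) ^ (1 / 2 : ℝ) ∂ν ≤ c := by
    rintro y ν rfl
    haveI := 𝒳.isProbabilityMeasure_condKernel y hst
    calc ∫⁻ x, (variance (Measure.dirac x) (𝒳.condKernel y s)) ^ (1 / 2 : ℝ) ∂(𝒳.condKernel y s)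
        ≤ (∫⁻ x, variance (Measure.dirac x) (𝒳.condKernel y s) ∂(𝒳.condKernel y s)) ^ (1 / 2 : ℝ) :=
          lintegral_rpow_half_le _ (measurable_variance_dirac _).aemeasurable
      _ = (variance (𝒳.condKernel y s) (𝒳.condKernel y s)) ^ (1 / 2 : ℝ) := by
          rw [lintegral_variance_dirac]
      _ ≤ c := ENNReal.rpow_le_rpow (hH.variance_condKernel_self_le_ofReal hst y) (by norm_num)
  -- integrate the pointwise Minkowski bound over `ν₁ ⊗ ν₂`
  calc (variance ν₁ ν₂) ^ (1 / 2 : ℝ)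
      = ∫⁻ _, ∫⁻ _, (variance ν₁ ν₂) ^ (1 / 2 : ℝ) ∂ν₂ ∂ν₁ := by
        rw [lintegral_const, lintegral_const, measure_univ, mul_one, measure_univ, mul_one]
    _ ≤ ∫⁻ x₁, ∫⁻ x₂, (edist x₁ x₂ + (variance (Measure.dirac x₁) ν₁) ^ (1 / 2 : ℝ) +
          (variance (Measure.dirac x₂) ν₂) ^ (1 / 2 : ℝ)) ∂ν₂ ∂ν₁ :=
        lintegral_mono fun x₁ ↦ lintegral_mono fun x₂ ↦ rpow_half_variance_le_edist_add ν₁ ν₂ x₁ x₂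
    _ = ∫⁻ x₁, (∫⁻ x₂, edist x₁ x₂ ∂ν₂ + (variance (Measure.dirac x₁) ν₁) ^ (1 / 2 : ℝ) +
          ∫⁻ x₂, (variance (Measure.dirac x₂) ν₂) ^ (1 / 2 : ℝ) ∂ν₂) ∂ν₁ := by
        refine lintegral_congr fun x₁ ↦ ?_
        rw [lintegral_add_right _ hm₂, lintegral_add_right _ measurable_const, lintegral_const,
          measure_univ, mul_one]
    _ ≤ ∫⁻ x₁, (∫⁻ x₂, edist x₁ x₂ ∂ν₂ + (variance (Measure.dirac x₁) ν₁) ^ (1 / 2 : ℝ) + c) ∂ν₁ := by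
        gcongr
        exact hJ ν₂ hν₂
    _ = ∫⁻ x₁, ∫⁻ x₂, edist x₁ x₂ ∂ν₂ ∂ν₁ +
          ∫⁻ x₁, (variance (Measure.dirac x₁) ν₁) ^ (1 / 2 : ℝ) ∂ν₁ + c := by
        rw [lintegral_add_right _ measurable_const, lintegral_add_right _ hm₁, lintegral_const,
          measure_univ, mul_one]
    _ ≤ ∫⁻ x₁, ∫⁻ x₂, edist x₁ x₂ ∂ν₂ ∂ν₁ + c + c := by
        gcongr
        exact hJ ν₁ hν₁
    _ = _ := by rw [two_mul, add_assoc]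

/-- **The pointwise bound** (Bamler 2023, §4.2, proof of the Lemma, the display before
"Now (4.4) follows"): `d_t(y₁, y₂) − ∫∫ d_s dν_{y₁;s} dν_{y₂;s} ≤
√(d_t²(y₁, y₂) − Var(ν_{y₁;s}, ν_{y₂;s}) + H(t − s)) + 2√(H(t − s))`, additive `[0, ∞]` form.
[cite: Bamler2023, §4.2, proof of the Lemma (almost monotonicity), fourth and fifth displays] -/
theorem IsHConcentrated.edist_le_lintegral_lintegral_add {H : ℝ} (hH : 𝒳.IsHConcentrated H)
    (hH0 : 0 ≤ H) {s t : I} (hst : (s : ℝ) ≤ t) (y₁ y₂ : 𝒳.Slice t) :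
    edist y₁ y₂ ≤ ∫⁻ x₁, ∫⁻ x₂, edist x₁ x₂ ∂(𝒳.condKernel y₂ s) ∂(𝒳.condKernel y₁ s) +
      ((edist y₁ y₂ ^ 2 + ENNReal.ofReal (H * ((t : ℝ) - s))) -
          variance (𝒳.condKernel y₁ s) (𝒳.condKernel y₂ s)) ^ (1 / 2 : ℝ) +
      2 * (ENNReal.ofReal (H * ((t : ℝ) - s))) ^ (1 / 2 : ℝ) := by
  have hconc : variance (𝒳.condKernel y₁ s) (𝒳.condKernel y₂ s) ≤
      edist y₁ y₂ ^ 2 + ENNReal.ofReal (H * ((t : ℝ) - s)) := hH hst y₁ y₂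
  have h1 := edist_le_rpow_half_add_rpow_half y₁ y₂ (mul_nonneg hH0 (sub_nonneg.2 hst)) hconc
  have h2 := hH.rpow_half_variance_condKernel_le hst y₁ y₂
  calc edist y₁ y₂ ≤ (variance (𝒳.condKernel y₁ s) (𝒳.condKernel y₂ s)) ^ (1 / 2 : ℝ) +
        ((edist y₁ y₂ ^ 2 + ENNReal.ofReal (H * ((t : ℝ) - s))) -
          variance (𝒳.condKernel y₁ s) (𝒳.condKernel y₂ s)) ^ (1 / 2 : ℝ) := h1
    _ ≤ (∫⁻ x₁, ∫⁻ x₂, edist x₁ x₂ ∂(𝒳.condKernel y₂ s) ∂(𝒳.condKernel y₁ s) +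
        2 * (ENNReal.ofReal (H * ((t : ℝ) - s))) ^ (1 / 2 : ℝ)) +
        ((edist y₁ y₂ ^ 2 + ENNReal.ofReal (H * ((t : ℝ) - s))) -
          variance (𝒳.condKernel y₁ s) (𝒳.condKernel y₂ s)) ^ (1 / 2 : ℝ) := add_le_add h2 le_rfl
    _ = _ := by ring

/-- **The upper bound in Bamler 2023, (4.4)**: for an `H`-concentrated metric flow (`H ≥ 0`), a
conjugate heat flow `(μ_t)_{t ∈ I'}` with `Var(μ_t) < ∞`, and `s ≤ t` in `I'`,
`∫∫ d_t dμ_t dμ_t ≤ ∫∫ d_s dμ_s dμ_s + √(Var(μ_t) − Var(μ_s) + H(t − s)) + 2√(H(t − s))`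
(additive `[0, ∞]` form; `Var(μ_s) ≤ Var(μ_t) + H(t − s)`). Printed proof: integrate the pointwise
bound over `μ_t ⊗ μ_t`, use `∫∫ (∫∫ d_s dν_{y₁;s} dν_{y₂;s}) dμ_t dμ_t = ∫∫ d_s dμ_s dμ_s`,
Cauchy–Schwarz, and `∫∫ (d_t² − Var(ν_{y₁;s}, ν_{y₂;s}) + H(t − s)) dμ_t dμ_t = Var(μ_t) − Var(μ_s) + H(t − s)`.
[cite: Bamler2023, §4.2, Lemma (almost monotonicity of the average distance), (4.4), upper bound] -/
theorem IsHConcentrated.lintegral_lintegral_edist_le_add_sqrt {H : ℝ} (hH : 𝒳.IsHConcentrated H)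
    (hH0 : 0 ≤ H) {I' : Set ℝ} {μ : ∀ t : I, Measure (𝒳.Slice t)}
    (hμ : 𝒳.IsConjugateHeatFlow I' μ) {s t : I} (hs : (s : ℝ) ∈ I') (ht : (t : ℝ) ∈ I')
    (hst : (s : ℝ) ≤ t) (hVt : variance (μ t) (μ t) ≠ ∞) :
    ∫⁻ y₁, ∫⁻ y₂, edist y₁ y₂ ∂(μ t) ∂(μ t) ≤
      ∫⁻ x₁, ∫⁻ x₂, edist x₁ x₂ ∂(μ s) ∂(μ s) +
      ((variance (μ t) (μ t) + ENNReal.ofReal (H * ((t : ℝ) - s))) - variance (μ s) (μ s)) ^ (1 / 2 : ℝ) +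
      2 * (ENNReal.ofReal (H * ((t : ℝ) - s))) ^ (1 / 2 : ℝ) := by
  haveI := hμ.1 t ht
  haveI := hμ.1 s hs
  haveI : SecondCountableTopology (𝒳.Slice s) := UniformSpace.secondCountable_of_separable _
  haveI : SecondCountableTopology (𝒳.Slice t) := UniformSpace.secondCountable_of_separable _
  set κ : Kernel (𝒳.Slice t) (𝒳.Slice s) := 𝒳.kernel hst with hκ
  set m : Measure (𝒳.Slice t) := μ t with hm
  set hh : ℝ≥0∞ := ENNReal.ofReal (H * ((t : ℝ) - s)) with hhh
  have hb : μ s = m.bind κ := hμ.eq_bind hs ht hst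
  -- measurability
  have hg : Measurable fun a : 𝒳.Slice s × 𝒳.Slice t ↦ ∫⁻ x₂, edist a.1 x₂ ∂(κ a.2) := by
    have h := Measurable.lintegral_kernel_prod_right (κ := Kernel.prodMkLeft (𝒳.Slice s) κ)
      (f := fun (a : 𝒳.Slice s × 𝒳.Slice t) (b : 𝒳.Slice s) ↦ edist a.1 b)
      (continuous_fst.fst.edist continuous_snd).measurable
    simpa only [Kernel.prodMkLeft_apply] using h
  have hD : Measurable fun b : 𝒳.Slice t × 𝒳.Slice t ↦ ∫⁻ x₁, ∫⁻ x₂, edist x₁ x₂ ∂(κ b.2) ∂(κ b.1) := by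
    have h := Measurable.lintegral_kernel_prod_right (κ := Kernel.prodMkRight (𝒳.Slice t) κ)
      (f := fun (b : 𝒳.Slice t × 𝒳.Slice t) (x₁ : 𝒳.Slice s) ↦ ∫⁻ x₂, edist x₁ x₂ ∂(κ b.2))
      (hg.comp (measurable_snd.prodMk measurable_fst.snd))
    simpa only [Kernel.prodMkRight_apply] using h
  have hd2 : Measurable fun p : 𝒳.Slice s × 𝒳.Slice s ↦ edist p.1 p.2 ^ 2 := measurable_edist_sq
  have hG : Measurable fun p : 𝒳.Slice s × 𝒳.Slice t ↦ ∫⁻ x', edist p.1 x' ^ 2 ∂κ p.2 := by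
    have := Measurable.lintegral_kernel_prod_right (κ := κ.comap Prod.snd measurable_snd)
      (f := fun (p : 𝒳.Slice s × 𝒳.Slice t) (x' : 𝒳.Slice s) ↦ edist p.1 x' ^ 2)
      (hd2.comp ((measurable_fst.comp measurable_fst).prodMk measurable_snd))
    simpa [Kernel.comap_apply] using this
  have hVm : Measurable fun p : 𝒳.Slice t × 𝒳.Slice t ↦ variance (κ p.1) (κ p.2) := by
    have := Measurable.lintegral_kernel_prod_right (κ := κ.comap Prod.fst measurable_fst)
      (f := fun (p : 𝒳.Slice t × 𝒳.Slice t) (x : 𝒳.Slice s) ↦ ∫⁻ x', edist x x' ^ 2 ∂κ p.2)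
      (hG.comp (measurable_snd.prodMk (measurable_snd.comp measurable_fst)))
    simpa [Kernel.comap_apply, variance_def] using this
  -- the three terms of the pointwise bound as functions of `(y₁, y₂)`
  set D : 𝒳.Slice t × 𝒳.Slice t → ℝ≥0∞ :=
    fun b ↦ ∫⁻ x₁, ∫⁻ x₂, edist x₁ x₂ ∂(κ b.2) ∂(κ b.1) with hD_def
  set Q : 𝒳.Slice t × 𝒳.Slice t → ℝ≥0∞ :=
    fun b ↦ ((edist b.1 b.2 ^ 2 + hh) - variance (κ b.1) (κ b.2)) ^ (1 / 2 : ℝ) with hQ_def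
  have hQm : Measurable Q := ((measurable_edist.pow_const 2).add measurable_const).sub hVm
    |>.pow_const _
  have hDy : ∀ y₁, Measurable fun y₂ ↦ D (y₁, y₂) := fun y₁ ↦ hD.comp (measurable_const.prodMk measurable_id)
  have hQy : ∀ y₁, Measurable fun y₂ ↦ Q (y₁, y₂) := fun y₁ ↦ hQm.comp (measurable_const.prodMk measurable_id)
  -- Step 1: integrate the pointwise bound
  have step1 : ∫⁻ y₁, ∫⁻ y₂, edist y₁ y₂ ∂m ∂m ≤
      ∫⁻ y₁, ∫⁻ y₂, D (y₁, y₂) ∂m ∂m + ∫⁻ y₁, ∫⁻ y₂, Q (y₁, y₂) ∂m ∂m + 2 * hh ^ (1 / 2 : ℝ) := by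
    calc ∫⁻ y₁, ∫⁻ y₂, edist y₁ y₂ ∂m ∂m
        ≤ ∫⁻ y₁, ∫⁻ y₂, (D (y₁, y₂) + Q (y₁, y₂) + 2 * hh ^ (1 / 2 : ℝ)) ∂m ∂m :=
          lintegral_mono fun y₁ ↦ lintegral_mono fun y₂ ↦
            hH.edist_le_lintegral_lintegral_add hH0 hst y₁ y₂
      _ = ∫⁻ y₁, (∫⁻ y₂, D (y₁, y₂) ∂m + ∫⁻ y₂, Q (y₁, y₂) ∂m + 2 * hh ^ (1 / 2 : ℝ)) ∂m := by
          refine lintegral_congr fun y₁ ↦ ?_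
          rw [lintegral_add_right _ measurable_const, lintegral_add_right _ (hQy y₁), lintegral_const,
            measure_univ, mul_one]
      _ = _ := by
          rw [lintegral_add_right _ measurable_const, lintegral_add_right _ hQm.lintegral_prod_right',
            lintegral_const, measure_univ, mul_one]
  -- Step 2: `∫∫ D dμ_t dμ_t = ∫∫ d_s dμ_s dμ_s`
  have step2 : ∫⁻ y₁, ∫⁻ y₂, D (y₁, y₂) ∂m ∂m = ∫⁻ x₁, ∫⁻ x₂, edist x₁ x₂ ∂(μ s) ∂(μ s) := by
    -- innermost: `∫_{y₂} ∫_{x₂} e(x₁, x₂) dν_{y₂} dμ_t = ∫_{x₂} e dμ_s`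
    have hin : ∀ x₁ : 𝒳.Slice s, ∫⁻ y₂, ∫⁻ x₂, edist x₁ x₂ ∂(κ y₂) ∂m = ∫⁻ x₂, edist x₁ x₂ ∂(μ s) :=
      fun x₁ ↦ by
      rw [hb, Measure.lintegral_bind κ.measurable.aemeasurable
        (show Measurable (fun x₂ : 𝒳.Slice s ↦ edist x₁ x₂) from
          measurable_const.edist measurable_id).aemeasurable]
    have hGm : Measurable fun x₁ : 𝒳.Slice s ↦ ∫⁻ x₂, edist x₁ x₂ ∂(μ s) :=
      measurable_edist.lintegral_prod_right'
    calc ∫⁻ y₁, ∫⁻ y₂, D (y₁, y₂) ∂m ∂m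
        = ∫⁻ y₁, ∫⁻ x₁, ∫⁻ y₂, ∫⁻ x₂, edist x₁ x₂ ∂(κ y₂) ∂m ∂(κ y₁) ∂m := by
          refine lintegral_congr fun y₁ ↦ ?_
          have hg' : Measurable (Function.uncurry fun (y₂ : 𝒳.Slice t) (x₁ : 𝒳.Slice s) ↦
              ∫⁻ x₂, edist x₁ x₂ ∂(κ y₂)) := hg.comp (measurable_snd.prodMk measurable_fst)
          show ∫⁻ y₂, ∫⁻ x₁, ∫⁻ x₂, edist x₁ x₂ ∂(κ y₂) ∂(κ y₁) ∂m = _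
          exact lintegral_lintegral_swap hg'.aemeasurable
      _ = ∫⁻ y₁, ∫⁻ x₁, ∫⁻ x₂, edist x₁ x₂ ∂(μ s) ∂(κ y₁) ∂m := by
          simp_rw [hin]
      _ = ∫⁻ x₁, ∫⁻ x₂, edist x₁ x₂ ∂(μ s) ∂(μ s) := by
          rw [← Measure.lintegral_bind κ.measurable.aemeasurable hGm.aemeasurable, ← hb]
  -- Step 3: Cauchy–Schwarz for `Q`
  have step3 : ∫⁻ y₁, ∫⁻ y₂, Q (y₁, y₂) ∂m ∂m ≤
      ((variance m m + hh) - variance (μ s) (μ s)) ^ (1 / 2 : ℝ) := by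
    set π : Measure (𝒳.Slice t × 𝒳.Slice t) := m.prod m with hπ
    have hVle : ∀ b : 𝒳.Slice t × 𝒳.Slice t, variance (κ b.1) (κ b.2) ≤ edist b.1 b.2 ^ 2 + hh :=
      fun b ↦ hH hst b.1 b.2
    have hVint : ∫⁻ b, variance (κ b.1) (κ b.2) ∂π = variance (μ s) (μ s) := by
      rw [hπ, lintegral_prod _ hVm.aemeasurable, hb]
      exact (variance_comp_comp κ κ m m).symm
    have hVfin : ∫⁻ b, variance (κ b.1) (κ b.2) ∂π ≠ ∞ := by
      rw [hVint]
      refine ne_top_of_le_ne_top ?_ (hH.variance_le_variance_add hμ hμ hs ht hst)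
      exact ENNReal.add_ne_top.2 ⟨hVt, ENNReal.ofReal_ne_top⟩
    have he2 : ∫⁻ b, (edist b.1 b.2 ^ 2 + hh) ∂π = variance m m + hh := by
      rw [lintegral_add_right _ measurable_const, lintegral_const, measure_univ, mul_one, hπ,
        variance_def, lintegral_prod _ measurable_edist_sq.aemeasurable]
    calc ∫⁻ y₁, ∫⁻ y₂, Q (y₁, y₂) ∂m ∂m = ∫⁻ b, Q b ∂π := by rw [hπ, lintegral_prod _ hQm.aemeasurable]
      _ ≤ (∫⁻ b, (edist b.1 b.2 ^ 2 + hh) - variance (κ b.1) (κ b.2) ∂π) ^ (1 / 2 : ℝ) :=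
          lintegral_rpow_half_le π
            (((measurable_edist.pow_const 2).add measurable_const).sub hVm).aemeasurable
      _ = ((variance m m + hh) - variance (μ s) (μ s)) ^ (1 / 2 : ℝ) := by
          rw [lintegral_sub hVm hVfin (Eventually.of_forall hVle), he2, hVint]
  -- assemble
  calc ∫⁻ y₁, ∫⁻ y₂, edist y₁ y₂ ∂m ∂m
      ≤ ∫⁻ y₁, ∫⁻ y₂, D (y₁, y₂) ∂m ∂m + ∫⁻ y₁, ∫⁻ y₂, Q (y₁, y₂) ∂m ∂m + 2 * hh ^ (1 / 2 : ℝ) := step1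
    _ ≤ ∫⁻ x₁, ∫⁻ x₂, edist x₁ x₂ ∂(μ s) ∂(μ s) +
        ((variance m m + hh) - variance (μ s) (μ s)) ^ (1 / 2 : ℝ) + 2 * hh ^ (1 / 2 : ℝ) := by
        rw [step2]
        gcongr

end MetricFlow

end Literature.Geometry.Riemannian

end
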